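import Literature.AnabelianGeometry.EtaleTheta.GalSectCuspTorsorStructureGroupKummer
import Literature.AnabelianGeometry.EtaleTheta.GalSectSplittingsCohomologyChi
import Literature.AnabelianGeometry.EtaleTheta.SettingModelChiCuspGroupLevel
import Literature.AnabelianGeometry.EtaleTheta.SettingModelTateCuspGroupLevel
import Literature.AnabelianGeometry.EtaleTheta.GalSectSplittingsCohomologyTate
import HarnessLib

/-!
# [GalSect] §4 torsor AT A CARRIER: at the `b`-axis cusp of the χ-twisted model `curveχ′` the structure group of the GENUINE
# `H¹`-torsor `cuspTorsorH1χ` IS `(ℚ_pˣ)^∧` — non-vacuity of the (B4) assembly p468879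

S. Mochizuki, *Galois sections in absolute anabelian geometry* [GalSect], Nagoya Math. J. **179** (2005), §4 p. 33 («the splittings … form a
torsor over `H¹(G_K, Ẑ(1)) ≅ (K^×)^∧`») [cite: MochizukiGalSect2005, §4 p.33]; [SemiAnbd] §6 p. 71 («`I_x ≅ Ẑ(1)`»)
[cite: MochizukiSemiAnbd2006, §6 p.71].

abc-iut cell, layer L2, seat abc-iut-w5-d029 (gen 7); NON-VACUITY sequel of the (B4) assembly of record p468879
(`GalSect.nonempty_kxHat_mulEquiv_resKer_of_isCyclotomicCusp`: «`I_x ≅ Ẑ(1)`» + `D_x` compact + `aug(D_x) = G_K` ⇒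
`(K^×)^∧ ≃* Ker(res)`).  PROOF-ONLY (no definition, no `Prop` fact, no instance).  At the R78 χ-TWISTED ROOT MODEL WITH A CUSP
`curveχ′ p` (abc-iut-w5-d029 p429840: `Π^tp = Γ ⋊_χ G_{ℚ_p}`, cusp decomposition group `b^Ẑ ⋊ G_{ℚ_p}`, `K = ℚ_p`) ALL THREE hypotheses
are THEOREMS of the tree — clause (1) `isCyclotomicCusp_curveχ'` (p452745), `isCompact_cuspDecompχ` (abc-iut-w5-d140,
`SettingModelChiCuspGroupLevel`), `map_aug_decomp_curveχ'` (`aug(D_x) = G_{ℚ_p}`), with the base splitting `inrSplittingχ`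
(`GalSectSplittingsCohomologyChi`, whose `cuspTorsorH1χ` was the first un-vacuous §4 torsor of the tree, structure group `Ker(res)`):

* `SettingModel.nonempty_kxHat_mulEquiv_resKer_curveχ'` — **`(ℚ_pˣ)^∧ ≃* Ker(res : H¹(b^Ẑ ⋊ G_{ℚ_p}, b^Ẑ) → H¹(b^Ẑ, b^Ẑ))`**:
  the structure group of `cuspTorsorH1χ` IS `KxHat (curveχ′ p) = (ℚ_pˣ)^∧` — the (B4) theorem has an inhabited hypothesis set at a
  carrier (NV of the derivation «(gen) ⟸ print clauses» at the `TemperedCurve` level);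
* `SettingModel.nonempty_torsorData_kxHat_curveχ'` — hence the splitting classes at the χ′ cusp form a **`(ℚ_pˣ)^∧`-TORSOR whose
  action IS the genuine cohomological one** (`torsorDataH1` read through `κ`, abc-iut-w5-d029's `TorsorData.comapMulEquiv` p454786):
  the [GalSect] §4 sentence «torsor over `H¹(G_K, Ẑ(1)) ≅ (K^×)^∧`» INHABITED at a model with its Kummer structure group, not a bare
  bijection.

* §2, THE STAGE-2 TWINS `curveχq′ p i j` (abc-iut-L6-d6's R78 «honest Tate action + cusp», `Π^tp = Γ ⋊_{actχq} G_{ℚ_p}` with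
  `σ ↦ Inn(b^{κ_p(σ)^i}) ∘ shear(κ_p(σ)^j) ∘ θ_{χ(σ)}`): `SettingModel.isCyclotomicCusp_curveχq'` — **C7e clause (1) HOLDS at every stage-2
  twin** (the affine twist acts on the `b`-axis through `χ`: `actχq_bPowGfp`), extending p452745's census beyond stage 1; hence
  `nonempty_kxHat_mulEquiv_resKer_curveχq'` / `nonempty_torsorData_kxHat_curveχq'` — the same two NV statements at EVERY `(i, j)`
  (`isCompact_cuspDecompχq`, `map_aug_decomp_curveχq'`, `inrSplittingχq` BY NAME), in particular at the Tate model `(i, j) = (1, 2)`.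

HONEST FRAMING: `curveχ′` / `curveχq′` are semi-synthetic models (consistency evidence only; at the C-level its `DotCCusp` is empty, p443644/p445383 —
this is the `TemperedCurve`-level torsor); [GalSect]/[SemiAnbd] are refereed; no side taken on [IUTchIII] Cor. 3.12; typed ≠ proved.
-/

noncomputable section

namespace Literature.AnabelianGeometry.EtaleTheta.SettingModel

open Literature.AnabelianGeometry.SemiGraphs GalSect
open CategoryTheory ProfiniteGrp ProfiniteGrp.ProfiniteCompletion

variable (p : ℕ) [Fact p.Prime]

/-- **At the `b`-axis cusp of `curveχ′` the structure group of the genuine §4 torsor is `(ℚ_pˣ)^∧`**: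
`KxHat (curveχ′ p) ≃* Ker(res : H¹(D_x, I_x) → H¹(I_x, I_x))` at the base splitting `inr(G_{ℚ_p})` — p468879 with its three
hypotheses supplied by `isCyclotomicCusp_curveχ'`, `isCompact_cuspDecompχ`, `map_aug_decomp_curveχ'`. [cite: MochizukiGalSect2005, §4 p.33] -/
theorem nonempty_kxHat_mulEquiv_resKer_curveχ' :
    haveI := t2Space_PiTpχ p
    haveI : IsMulCommutative (cuspPairOf (curveχ' p) ()).I := (curveχ' p).isMulCommutative_inertia (x := ()) trivial
    haveI := (cuspPairOf (curveχ' p) ()).ID_normal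
    Nonempty (KxHat (curveχ' p) ≃* ContH1.resKer (cuspPairOf (curveχ' p) ()).ID (⊤ : Subgroup (cuspPairOf (curveχ' p) ()).D)
      ((cuspPairOf (curveχ' p) ()).isClosedComplement_of_mem_splittings (inrSplittingχ p)).le_left) :=
  haveI := t2Space_PiTpχ p
  GalSect.nonempty_kxHat_mulEquiv_resKer_of_isCyclotomicCusp (curveχ' p) (x := ()) trivial (isCyclotomicCusp_curveχ' p)
    (isCompact_cuspDecompχ p) (map_aug_decomp_curveχ' p ()) (inrSplittingχ p)

/-- **The splitting classes at the χ′ cusp form a `(ℚ_pˣ)^∧`-torsor whose action is the genuine `H¹`-action** (`cuspTorsorH1χ` read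
through an identification `κ : (ℚ_pˣ)^∧ ≃* Ker(res)`): the [GalSect] §4 torsor sentence inhabited at a model WITH its Kummer structure
group. [cite: MochizukiGalSect2005, §4 p.33] -/
theorem nonempty_torsorData_kxHat_curveχ' :
    haveI := t2Space_PiTpχ p
    haveI : IsMulCommutative (cuspPairOf (curveχ' p) ()).I := (curveχ' p).isMulCommutative_inertia (x := ()) trivial
    haveI := (cuspPairOf (curveχ' p) ()).ID_normal
    ∃ (κ : KxHat (curveχ' p) ≃* ContH1.resKer (cuspPairOf (curveχ' p) ()).ID (⊤ : Subgroup (cuspPairOf (curveχ' p) ()).D)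
        ((cuspPairOf (curveχ' p) ()).isClosedComplement_of_mem_splittings (inrSplittingχ p)).le_left)
      (T : (cuspPairOf (curveχ' p) ()).TorsorData (KxHat (curveχ' p))),
      ∀ k cl, T.act k cl = (cuspTorsorH1χ p).act (κ k) cl := by
  haveI := t2Space_PiTpχ p
  obtain ⟨κ⟩ := nonempty_kxHat_mulEquiv_resKer_curveχ' p
  exact ⟨κ, (cuspTorsorH1χ p).comapMulEquiv κ, fun _ _ => rfl⟩

/-! ### §2. The stage-2 twins `curveχq′ p i j`: clause (1) and the two NV statements -/

section StageTwo

variable (i j : ℤ)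

/-- **Conjugation on the `b`-axis inertia of `curveχq′` is the cyclotomic character**: for `d ∈ D_x = b^Ẑ ⋊ G_{ℚ_p}` (stage-2
action), `d · inl(b^t) · d⁻¹ = inl(b^{χ(aug d) t})` — the affine twist `affTwist₃Gfp ⟨(κ^i, κ^j), χ⟩` acts on the axis through its
`Ẑ^×`-component (`actχq_bPowGfp`). [cite: MochizukiEtTh2009, §1 p.13] -/
theorem conj_inl_bPowGfp_of_mem_cuspDecompχq {d : PiTpχq p i j} (hd : d ∈ cuspDecompχq p i j) (t : ZHat) :
    d * SemidirectProduct.inl (bPowGfp t) * d⁻¹ = SemidirectProduct.inl (bPowGfp (chi p (augχq p i j d) t)) := by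
  have hdl : d.left ∈ bAxisGfp := hd
  have hright : ∀ σ : GQp p, (tatePairHom p i j σ).right = chi p σ := fun _ => rfl
  refine SemidirectProduct.ext ?_ ?_
  · rw [SemidirectProduct.mul_left, SemidirectProduct.mul_left, SemidirectProduct.inv_left,
      SemidirectProduct.mul_right, SemidirectProduct.right_inl, mul_one, SemidirectProduct.left_inl,
      ← MulAut.mul_apply, ← map_mul, mul_inv_cancel, map_one, MulAut.one_apply, actχq_bPowGfp, hright, augχq_apply]
    rw [bAxisGfp_comm hdl (bPowGfp_mem_bAxisGfp _), mul_assoc, mul_inv_cancel, mul_one, SemidirectProduct.left_inl]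
  · rw [SemidirectProduct.mul_right, SemidirectProduct.mul_right, SemidirectProduct.inv_right,
      SemidirectProduct.right_inl, mul_one, mul_inv_cancel, SemidirectProduct.right_inl]

/-- The inverse of `inertiaEquivχq` on the nose: `t ↦ inl(b^t)`. [cite: MochizukiSemiAnbd2006, §6 p.71] -/
theorem inertiaEquivχq_symm_apply_coe (t : ZHat) :
    (((inertiaEquivχq p i j).symm t : ↥(cuspDecompχq p i j ⊓ (augχq p i j).toMonoidHom.ker)) : PiTpχq p i j) =
      SemidirectProduct.inl (bPowGfp t) := rfl

/-- **C7e clause (1) HOLDS at every stage-2 twin: the `b`-axis cusp of `curveχq′ p i j` is cyclotomic** («`I_x ≅ Ẑ(1)`» WITH the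
twist), extending p452745's `isCyclotomicCusp_curveχ'` to the honest-Tate-action carriers. [cite: MochizukiSemiAnbd2006, §6 p.71] -/
theorem isCyclotomicCusp_curveχq' : IsCyclotomicCusp (curveχq' p i j) () := by
  refine ⟨inertiaEquivχq p i j, fun d hd w => ?_⟩
  set t : ZHat := inertiaEquivχq p i j w with ht
  have hw : (w : PiTpχq p i j) = SemidirectProduct.inl (bPowGfp t) := by
    rw [← inertiaEquivχq_symm_apply_coe p i j t, ht, ContinuousMulEquiv.symm_apply_apply]
  have hconj : (⟨d * w * d⁻¹, (cuspPairOf (curveχq' p i j) ()).conj_mem_I hd w.2⟩ :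
      ↥(cuspDecompχq p i j ⊓ (augχq p i j).toMonoidHom.ker)) = (inertiaEquivχq p i j).symm (chi p (augχq p i j d) t) := by
    apply Subtype.ext
    rw [inertiaEquivχq_symm_apply_coe]
    change d * (w : PiTpχq p i j) * d⁻¹ = _
    rw [hw]
    exact conj_inl_bPowGfp_of_mem_cuspDecompχq p i j hd t
  change inertiaEquivχq p i j ⟨d * w * d⁻¹, _⟩ = chi p (augχq p i j d) (inertiaEquivχq p i j w)
  rw [hconj, ContinuousMulEquiv.apply_symm_apply]

/-- **At the cusp of EVERY stage-2 twin `curveχq′ p i j` the structure group of the genuine §4 torsor is `(ℚ_pˣ)^∧`** (p468879 with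
`isCyclotomicCusp_curveχq'`, `isCompact_cuspDecompχq`, `map_aug_decomp_curveχq'`, base splitting `inrSplittingχq`); in particular at
the Tate model `(i, j) = (1, 2)`. [cite: MochizukiGalSect2005, §4 p.33] -/
theorem nonempty_kxHat_mulEquiv_resKer_curveχq' :
    haveI := t2Space_PiTpχq p i j
    haveI : IsMulCommutative (cuspPairOf (curveχq' p i j) ()).I := (curveχq' p i j).isMulCommutative_inertia (x := ()) trivial
    haveI := (cuspPairOf (curveχq' p i j) ()).ID_normal
    Nonempty (KxHat (curveχq' p i j) ≃* ContH1.resKer (cuspPairOf (curveχq' p i j) ()).ID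
      (⊤ : Subgroup (cuspPairOf (curveχq' p i j) ()).D)
      ((cuspPairOf (curveχq' p i j) ()).isClosedComplement_of_mem_splittings (inrSplittingχq p i j)).le_left) :=
  haveI := t2Space_PiTpχq p i j
  GalSect.nonempty_kxHat_mulEquiv_resKer_of_isCyclotomicCusp (curveχq' p i j) (x := ()) trivial
    (isCyclotomicCusp_curveχq' p i j) (isCompact_cuspDecompχq p i j) (map_aug_decomp_curveχq' p i j ()) (inrSplittingχq p i j)

/-- **The `(ℚ_pˣ)^∧`-torsor of splitting classes at the stage-2 cusp, with its genuine `H¹`-action** (`cuspTorsorH1` read through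
`κ`). [cite: MochizukiGalSect2005, §4 p.33] -/
theorem nonempty_torsorData_kxHat_curveχq' :
    haveI := t2Space_PiTpχq p i j
    haveI : IsMulCommutative (cuspPairOf (curveχq' p i j) ()).I := (curveχq' p i j).isMulCommutative_inertia (x := ()) trivial
    haveI := (cuspPairOf (curveχq' p i j) ()).ID_normal
    ∃ (κ : KxHat (curveχq' p i j) ≃* ContH1.resKer (cuspPairOf (curveχq' p i j) ()).ID
        (⊤ : Subgroup (cuspPairOf (curveχq' p i j) ()).D)
        ((cuspPairOf (curveχq' p i j) ()).isClosedComplement_of_mem_splittings (inrSplittingχq p i j)).le_left)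
      (T : (cuspPairOf (curveχq' p i j) ()).TorsorData (KxHat (curveχq' p i j))),
      ∀ k cl, T.act k cl = ((curveχq' p i j).cuspTorsorH1 (x := ()) trivial (inrSplittingχq p i j)).act (κ k) cl := by
  haveI := t2Space_PiTpχq p i j
  obtain ⟨κ⟩ := nonempty_kxHat_mulEquiv_resKer_curveχq' p i j
  exact ⟨κ, ((curveχq' p i j).cuspTorsorH1 (x := ()) trivial (inrSplittingχq p i j)).comapMulEquiv κ, fun _ _ => rfl⟩

end StageTwo

end Literature.AnabelianGeometry.EtaleTheta.SettingModel

end
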